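import Summits.Ventures.PercRepro.C041ZonePortCSCaseIV
import Summits.Ventures.PercRepro.C041ZonePortCSAndDefs

/-!
# THEOREM R-CS with the validity `V_∧` — case (iv), pure-type gates of both types (p6, gen 28)

Setting of `C041ZonePortCSAndDefs`; the charging of `C041ZonePortCSCaseIV` verbatim for the validity `V_∧`
(reddening two edges keeps `X₁ ∧ X₂`: `validAnd_update2`): **`csAnd_of_pure_gates_mixed`**.
-/

namespace PercRepro

namespace ZonePort

namespace Problem

open Finset CSCount

variable {V E : Type*}

/-- Reddening two edges keeps the validity `V_∧`. -/
theorem validAnd_update2 [DecidableEq E] {P : Problem V E} {x : P.Term → Bool} (hx : P.ValidAnd x) (e f : P.Term) :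
    P.ValidAnd (Function.update (Function.update x e true) f true) :=
  ⟨adm_update_true (adm_update_true hx.1 e) f, valAnd_update _ f (valAnd_update _ e hx.2)⟩

section CaseIV

variable [Fintype E] [DecidableEq E] [DecidableEq V] {P : Problem V E}

/-- **Case (iv), both pure types present**: a 1-edge `e` at a gate of type `{1}` and a 2-edge `f` at a gate of type
`{2}` give `#valid ≤ #Good₁ + #Good₂`, hence (CS). -/
theorem csAnd_of_pure_gates_mixed {e f : P.Term} (hCe : P.IsGate (P.tz e.1)) (hCf : P.IsGate (P.tz f.1))
    (he : P.ts e.1 = false) (hf : P.ts f.1 = true) (hpe : P.Pure₁ (P.tz e.1)) (hpf : P.Pure₂ (P.tz f.1)) :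
    P.CSAnd := by
  classical
  apply cs_of_le
  have hef : e ≠ f := fun h => by
    rw [h] at he
    rw [he] at hf
    exact Bool.noConfusion hf
  -- the closed patterns
  set BB := P.validAndSet.filter fun x => x e = false ∧ x f = false with hBB
  have hcover : P.validAndSet ⊆ P.good₁AndSet ∪ P.good₂AndSet ∪ BB := by
    intro x hx
    have hxv := mem_validAndSet.1 hx
    by_cases hxe : x e = true
    · exact mem_union_left _ (mem_union_right _ (mem_good₂AndSet.2 ⟨hxv, good₂_of_red_pure_gate hCe he hpe hxe⟩))
    · by_cases hxf : x f = true
      · exact mem_union_left _ (mem_union_left _ (mem_good₁AndSet.2 ⟨hxv, good₁_of_red_pure_gate hCf hf hpf hxf⟩))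
      · exact mem_union_right _ (mem_filter.2 ⟨hx, bool_eq_false_of_not_true hxe, bool_eq_false_of_not_true hxf⟩)
  have h1 : #(P.validAndSet) ≤ #(P.good₁AndSet ∪ P.good₂AndSet ∪ BB) := card_le_card hcover
  have h2 : #(P.good₁AndSet ∪ P.good₂AndSet ∪ BB) ≤ #(P.good₁AndSet ∪ P.good₂AndSet) + #BB := card_union_le _ _
  have h3 : #(P.good₁AndSet ∪ P.good₂AndSet) + #(P.good₁AndSet ∩ P.good₂AndSet) = #(P.good₁AndSet) + #(P.good₂AndSet) :=
    card_union_add_card_inter _ _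
  -- the closed patterns inject into the patterns Good on both sides
  have h4 : #BB ≤ #(P.good₁AndSet ∩ P.good₂AndSet) := by
    refine card_le_card_of_injOn (fun x => Function.update (Function.update x e true) f true) ?_ ?_
    · intro x hx
      rw [Finset.mem_coe, hBB, mem_filter, mem_validAndSet] at hx
      rw [Finset.mem_coe, mem_inter, mem_good₁AndSet, mem_good₂AndSet]
      have hv := validAnd_update2 hx.1 e f
      have hxe' : Function.update (Function.update x e true) f true e = true := by
        rw [Function.update_of_ne hef, Function.update_self]
      have hxf' : Function.update (Function.update x e true) f true f = true := Function.update_self _ _ _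
      exact ⟨⟨hv, good₁_of_red_pure_gate hCf hf hpf hxf'⟩, ⟨hv, good₂_of_red_pure_gate hCe he hpe hxe'⟩⟩
    · intro x hx y hy hxy
      rw [Finset.mem_coe, hBB, mem_filter] at hx hy
      exact update2_injOn e f false false ⟨hx.2.1, hx.2.2⟩ ⟨hy.2.1, hy.2.2⟩ hxy
  omega

end CaseIV

end Problem

end ZonePort

end PercRepro
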